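import Literature.NumberTheory.EllipticCurves.SwanConductorTorsionProofs
import Literature.NumberTheory.EllipticCurves.TorsionCardinality
import HarnessLib

/-!
# A division-polynomial criterion for NON-surjectivity of the mod-`p` Galois representation

THEOREMS ONLY (no definition, no named fact). For an elliptic curve `E = W/F` over a field `F`
(`char F ∤ p`) and an odd prime `p`:

* `exists_smul_eq_of_hasSurjectiveModNGaloisRep` — if `ρ̄_{E,p} : Γ_F → Aut(E[p])` is onto then
  `Γ_F` acts TRANSITIVELY on `E[p] ∖ {O}` (`GL₂(𝔽_p)` is transitive on non-zero vectors).
* `not_hasSurjectiveModNGaloisRep_of_aeval_eq_zero_of_ne` — consequently, if some polynomial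
  `g ∈ F[X]` vanishes at the `x`-coordinate of ONE non-zero `p`-torsion point but not at another
      , then
  `ρ̄_{E,p}` is NOT onto (the set `{P ∈ E[p] ∖ O : g(x(P)) = 0}` is `Γ_F`-stable, non-empty
      , proper).
* `exists_geomTorsion_of_eval_ΨSq_eq_zero` — every root `α ∈ F̄` of the division polynomial `ΨSq_p`
  is the `x`-coordinate of a non-zero `p`-torsion point (Silverman *AEC* Ex. 3.7 (f), tree theorem
  `zsmul_some_eq_zero_iff_eval_ΨSq`).
* `exists_geomTorsion_eval_ne_zero` — a non-zero `g ∈ F̄[X]` of degree `≤ p` misses the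
  `x`-coordinate of some non-zero `p`-torsion point (the `p + 1` points `P₂, P₁ + j P₂` of a basis
  `(P₁, P₂)` of `E[p] ≅ 𝔽_p²` have pairwise distinct `x`-coordinates).
* `not_hasSurjectiveModNGaloisRep_of_dvd_preΨ` — THE CRITERION: if `g ∈ F[X]` with
  `0 < deg g ≤ p` divides the `p`-division polynomial `preΨ_p = ψ_p` of `W`, then `ρ̄_{E,p}` is not
  surjective. Typical use: `ρ̄_{E,p}(Γ_F)` inside the normaliser of a split Cartan subgroup stabilises
  a pair of lines `{L₁, L₂}` of `E[p]`
      , and the `p − 1` `x`-coordinates of `(L₁ ∪ L₂) ∖ O` are the roots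
  of a degree-`(p − 1)` factor of `ψ_p` over `F` (Zywina 2015 §1.3–1.4, the curves `X_{N_s(p)}`).

References: J.-P. Serre, Invent. Math. 15 (1972), §2; J. H. Silverman, *AEC* (2009), III.§7,
Exercise 3.7; D. Zywina, arXiv:1508.07660 (2015), §1.
-/

noncomputable section

open scoped Classical
open Polynomial Field

universe u

namespace WeierstrassCurve

open Literature.NumberTheory.EllipticCurves

/-! ### Linear algebra: `GL(V)` is transitive on non-zero vectors -/

/-- In a finite-dimensional vector space of dimension `≥ 2`... in fact of any dimension `≥ 1`: two
non-zero vectors are exchanged by a linear automorphism (here: dimension exactly `2`, by completing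
each to a basis). [folklore] -/
private theorem exists_linearEquiv_apply_eq_of_finrank_eq_two {k V : Type*} [Field k] [AddCommGroup V]
    [Module k V] (h2 : Module.finrank k V = 2) {v w : V} (hv : v ≠ 0) (hw : w ≠ 0) :
    ∃ f : V ≃ₗ[k] V, f v = w := by
  have hpos : 0 < Module.finrank k V := by omega
  have h1 : 1 < Module.finrank k V := by omega
  haveI : FiniteDimensional k V := .of_finrank_pos hpos
  obtain ⟨v', hv'⟩ := exists_linearIndependent_pair_of_one_lt_finrank h1 hv
  obtain ⟨w', hw'⟩ := exists_linearIndependent_pair_of_one_lt_finrank h1 hw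
  have hcard : Fintype.card (Fin 2) = Module.finrank k V := by rw [Fintype.card_fin, h2]
  let bv := basisOfLinearIndependentOfCardEqFinrank hv' hcard
  let bw := basisOfLinearIndependentOfCardEqFinrank hw' hcard
  refine ⟨bv.equiv bw (Equiv.refl _), ?_⟩
  have h0 : v = bv 0 := by
    simp only [bv, coe_basisOfLinearIndependentOfCardEqFinrank, Matrix.cons_val_zero]
  rw [h0, Module.Basis.equiv_apply]
  simp only [bw, coe_basisOfLinearIndependentOfCardEqFinrank, Equiv.refl_apply
      , Matrix.cons_val_zero]

section Torsion

variable {F : Type u} [Field F] (W : WeierstrassCurve F) [W.IsElliptic]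

/-! ### Transitivity of `Γ_F` on `E[p] ∖ O` under surjectivity -/

/-- **If `ρ̄_{E,p}` is onto `Aut(E[p])`, then `Γ_F` acts transitively on the non-zero `p`-torsion
points** (`p` prime, `p ≠ char F`): `E[p] ≅ 𝔽_p²` (`finrank_geomTorsion_eq_two`), two non-zero
vectors are exchanged by some `f ∈ GL(E[p])`, and `f = ρ̄(σ)`. [cite: Serre1972, §2.1] -/
theorem exists_smul_eq_of_hasSurjectiveModNGaloisRep (p : ℕ) [Fact p.Prime] (hpF : (p : F) ≠ 0)
    (hs : W.HasSurjectiveModNGaloisRep (p : ℤ)) {P Q : geomTorsion W (p : ℤ)} (hP : P ≠ 0)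
    (hQ : Q ≠ 0) : ∃ σ : absoluteGaloisGroup F, σ • P = Q := by
  letI : Module (ZMod p) (geomTorsion W (p : ℤ)) := AddSubgroup.torsionBy.zmodModule
  have h2 : Module.finrank (ZMod p) (geomTorsion W (p : ℤ)) = 2 :=
    W.finrank_geomTorsion_eq_two p hpF
  obtain ⟨f, hf⟩ := exists_linearEquiv_apply_eq_of_finrank_eq_two h2 hP hQ
  obtain ⟨σ, hσ⟩ := hs (Multiplicative.ofAdd f.toAddEquiv)
  refine ⟨σ, ?_⟩
  have h := galoisRepTorsion_apply W (p : ℤ) σ P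
  rw [hσ, toAdd_ofAdd] at h
  rw [← h]
  exact hf

/-! ### The criterion in terms of two torsion points -/

omit [W.IsElliptic] in
/-- The Galois action on a non-zero geometric point is the action on its coordinates (definitional).
[folklore] -/
private theorem smul_some_eq (σ : absoluteGaloisGroup F) {x y : AlgebraicClosure F}
    (h : (W.baseChange (AlgebraicClosure F)).toAffine.Nonsingular x y) :
    ∃ h', σ • (show geomPoints W from Affine.Point.some x y h) =
      (Affine.Point.some (σ • x) (σ • y) h' : geomPoints W) :=
  ⟨_, rfl⟩

/-- **Non-surjectivity from a polynomial separating two `p`-torsion `x`-coordinates.** If `g ∈ F[X]`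
vanishes at `x(P)` and not at `x(Q)` for two non-zero points `P, Q ∈ E[p]`, then `ρ̄_{E,p}` is not
onto: a `σ ∈ Γ_F` with `σP = Q` (transitivity) would give `g(x(Q)) = g(σ x(P)) = σ g(x(P)) = 0`.
[cite: Serre1972, §2.1] -/
theorem not_hasSurjectiveModNGaloisRep_of_aeval_eq_zero_of_ne (p : ℕ) [Fact p.Prime]
    (hpF : (p : F) ≠ 0) (g : F[X]) {P Q : geomTorsion W (p : ℤ)} (hP0 : P ≠ 0) (hQ0 : Q ≠ 0)
    {xP yP xQ yQ : AlgebraicClosure F}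
    {hP : (W.baseChange (AlgebraicClosure F)).toAffine.Nonsingular xP yP}
    {hQ : (W.baseChange (AlgebraicClosure F)).toAffine.Nonsingular xQ yQ}
    (hPe : (P : geomPoints W) = Affine.Point.some xP yP hP)
    (hQe : (Q : geomPoints W) = Affine.Point.some xQ yQ hQ)
    (hgP : aeval xP g = 0) (hgQ : aeval xQ g ≠ 0) : ¬ W.HasSurjectiveModNGaloisRep (p : ℤ) := by
  intro hs
  obtain ⟨σ, hσ⟩ := W.exists_smul_eq_of_hasSurjectiveModNGaloisRep p hpF hs hP0 hQ0
  have hcoe : ((σ • P : geomTorsion W (p : ℤ)) : geomPoints W) = σ • (P : geomPoints W) := rfl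
  obtain ⟨h', e'⟩ := W.smul_some_eq σ hP
  have hx : xQ = σ • xP := by
    have e := hQe
    rw [← hσ, hcoe, hPe, e'] at e
    exact (Affine.Point.some.inj e).1.symm
  have hσx : σ • xP = ((show AlgebraicClosure F ≃ₐ[F] AlgebraicClosure F from σ) :
      AlgebraicClosure F →ₐ[F] AlgebraicClosure F) xP := rfl
  apply hgQ
  rw [hx, hσx, Polynomial.aeval_algHom_apply, hgP, map_zero]

/-! ### Roots of the division polynomial are torsion `x`-coordinates -/

/-- Every `α ∈ F̄` is the `x`-coordinate of a point of `E(F̄)`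
    (solve the quadratic in `y`; the point
is non-singular because `E` is elliptic). [cite: SilvermanAEC2009, III.§1] -/
theorem exists_nonsingular_baseChange_algebraicClosure (α : AlgebraicClosure F) :
    ∃ y, (W.baseChange (AlgebraicClosure F)).toAffine.Nonsingular α y := by
  set V := W.baseChange (AlgebraicClosure F) with hV
  -- the quadratic `Y² + (a₁ α + a₃) Y − (α³ + a₂ α² + a₄ α + a₆)`
  let q : (AlgebraicClosure F)[X] :=
    X ^ 2 + C (V.a₁ * α + V.a₃) * X - C (α ^ 3 + V.a₂ * α ^ 2 + V.a₄ * α + V.a₆)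
  have hq : q.degree = 2 := by
    simp only [q]
    compute_degree!
  obtain ⟨y, hy⟩ := IsAlgClosed.exists_root q (by rw [hq]; norm_num)
  refine ⟨y, (Affine.equation_iff_nonsingular).mp ?_⟩
  rw [Affine.equation_iff]
  simp only [q, IsRoot.def, eval_sub, eval_add, eval_pow, eval_X, eval_mul, eval_C] at hy
  linear_combination hy

/-- **A root of `ΨSq_n` is the `x`-coordinate of a (non-zero) `n`-torsion point** of `E(F̄)`:
Silverman *AEC* Exercise 3.7 (f) (tree theorem `zsmul_some_eq_zero_iff_eval_ΨSq`).
[cite: SilvermanAEC2009, Exercise 3.7 (f)] -/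
theorem exists_geomTorsion_of_eval_ΨSq_eq_zero (n : ℤ) {α : AlgebraicClosure F}
    (hα : ((W.baseChange (AlgebraicClosure F)).ΨSq n).eval α = 0) :
    ∃ (P : geomTorsion W n) (y : AlgebraicClosure F)
      (h : (W.baseChange (AlgebraicClosure F)).toAffine.Nonsingular α y),
      (P : geomPoints W) = Affine.Point.some α y h := by
  obtain ⟨y, h⟩ := W.exists_nonsingular_baseChange_algebraicClosure α
  refine ⟨⟨(Affine.Point.some α y h : geomPoints W), ?_⟩, y, h, rfl⟩
  rw [mem_torsionBy_iff]
  exact ((W.baseChange (AlgebraicClosure F)).zsmul_some_eq_zero_iff_eval_ΨSq h n).mpr hα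

/-! ### A low-degree polynomial misses some torsion `x`-coordinate -/

/-- Two affine points with the same `x`-coordinate are equal or opposite (the negation formula
`−(x, y) = (x, −y − a₁x − a₃)`). [cite: SilvermanAEC2009, III.2.3 (Group Law Algorithm)] -/
theorem eq_or_eq_neg_of_some_x_eq {V : WeierstrassCurve (AlgebraicClosure F)} {x x' y y'}
    {h : V.toAffine.Nonsingular x y} {h' : V.toAffine.Nonsingular x' y'} (hxx : x' = x) :
    (Affine.Point.some x' y' h' : V.toAffine.Point) = Affine.Point.some x y h ∨
      (Affine.Point.some x' y' h' : V.toAffine.Point) = -Affine.Point.some x y h := by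
  subst hxx
  rcases Affine.Y_eq_of_X_eq h'.left h.left rfl with hyy | hyy
  · left; subst hyy; rfl
  · right
    rw [Affine.Point.neg_some]
    subst hyy; rfl

omit [W.IsElliptic] in
/-- A non-zero geometric point is an affine point `(x, y)`. [folklore] -/
private theorem exists_eq_some_of_ne_zero {P : geomPoints W} (hP : P ≠ 0) :
    ∃ (x y : AlgebraicClosure F) (h : (W.baseChange (AlgebraicClosure F)).toAffine.Nonsingular x y),
      P = Affine.Point.some x y h := by
  rcases P with _ | @⟨x, y, h⟩
  · exact absurd rfl hP
  · exact ⟨x, y, h, rfl⟩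

/-- **A non-zero polynomial `g ∈ F̄[X]` of degree `≤ p` misses the `x`-coordinate of some non-zero
`p`-torsion point** (`p` an odd prime, `p ≠ char F`): for a basis `(P₁, P₂)` of `E[p] ≅ 𝔽_p²`
the `p + 1` points `P₂` and `P₁ + j P₂` (`0 ≤ j < p`) are pairwise neither equal nor opposite, so
their `x`-coordinates are pairwise distinct, and `g` has at most `p` roots.
[cite: SilvermanAEC2009, Cor. III.6.4 (b)] -/
theorem exists_geomTorsion_eval_ne_zero (p : ℕ) [Fact p.Prime] (hp2 : p ≠ 2) (hpF : (p : F) ≠ 0)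
    (g : (AlgebraicClosure F)[X]) (hg0 : g ≠ 0) (hdeg : g.natDegree ≤ p) :
    ∃ (Q : geomTorsion W (p : ℤ)) (x y : AlgebraicClosure F)
      (h : (W.baseChange (AlgebraicClosure F)).toAffine.Nonsingular x y),
      (Q : geomPoints W) = Affine.Point.some x y h ∧ g.eval x ≠ 0 := by
  letI : Module (ZMod p) (geomTorsion W (p : ℤ)) := AddSubgroup.torsionBy.zmodModule
  have hp : p.Prime := Fact.out
  have h2 : Module.finrank (ZMod p) (geomTorsion W (p : ℤ)) = 2 :=
    W.finrank_geomTorsion_eq_two p hpF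
  haveI : FiniteDimensional (ZMod p) (geomTorsion W (p : ℤ)) := .of_finrank_pos (by omega)
  set B := Module.finBasisOfFinrankEq (ZMod p) (geomTorsion W (p : ℤ)) h2 with hB
  -- the `p + 1` points
  let f : Fin (p + 1) → geomTorsion W (p : ℤ) := fun j ↦
    if (j : ℕ) < p then B 0 + ((j : ℕ) : ZMod p) • B 1 else B 1
  -- linear combinations `c₀ B0 + c₁ B1` vanish only trivially
  have hcomb : ∀ c₀ c₁ : ZMod p, c₀ • B 0 + c₁ • B 1 = 0 → c₀ = 0 ∧ c₁ = 0 := by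
    intro c₀ c₁ hc
    have hli := B.linearIndependent
    rw [Fintype.linearIndependent_iff] at hli
    have h := hli ![c₀, c₁] (by simpa [Fin.sum_univ_two] using hc)
    exact ⟨h 0, h 1⟩
  have h2p : (2 : ZMod p) ≠ 0 := by
    intro h
    have := (ZMod.natCast_eq_zero_iff 2 p).mp (by exact_mod_cast h)
    exact hp2 ((Nat.prime_dvd_prime_iff_eq hp Nat.prime_two).mp this)
  -- coefficients determine the point
  have hrepr : ∀ c₀ c₁ d₀ d₁ : ZMod p, c₀ • B 0 + c₁ • B 1 = d₀ • B 0 + d₁ • B 1 →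
      c₀ = d₀ ∧ c₁ = d₁ := by
    intro c₀ c₁ d₀ d₁ h
    have h' := hcomb (c₀ - d₀) (c₁ - d₁) (by rw [sub_smul, sub_smul, sub_add_sub_comm, h, sub_self])
    exact ⟨sub_eq_zero.mp h'.1, sub_eq_zero.mp h'.2⟩
  -- the coefficient vector of `f j`
  let cf : Fin (p + 1) → ZMod p × ZMod p := fun j ↦
    if (j : ℕ) < p then (1, ((j : ℕ) : ZMod p)) else (0, 1)
  have hf : ∀ j, f j = (cf j).1 • B 0 + (cf j).2 • B 1 := by
    intro j
    simp only [f, cf]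
    split_ifs
    · rw [one_smul]
    · rw [zero_smul, zero_add, one_smul]
  have hneg : ∀ c₀ c₁ : ZMod p, -(c₀ • B 0 + c₁ • B 1) = (-c₀) • B 0 + (-c₁) • B 1 := by
    intro c₀ c₁; rw [neg_add, neg_smul, neg_smul]
  have hcast : ∀ {a b : ℕ}, a < p → b < p → ((a : ZMod p) = b) → a = b := by
    intro a b ha hb hab
    have := (ZMod.natCast_eq_natCast_iff' a b p).mp hab
    rwa [Nat.mod_eq_of_lt ha, Nat.mod_eq_of_lt hb] at this
  have hm1 : (-1 : ZMod p) ≠ 1 := fun h ↦ h2p (by linear_combination -h)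
  -- each `f j` is non-zero
  have hf0 : ∀ j, f j ≠ 0 := by
    intro j hj
    rw [hf j, show (0 : geomTorsion W (p : ℤ)) = (0 : ZMod p) • B 0 + (0 : ZMod p) • B 1 by
      rw [zero_smul, zero_smul, add_zero]] at hj
    have h := hrepr _ _ _ _ hj
    simp only [cf] at h
    split_ifs at h with hlt
    · exact one_ne_zero h.1
    · exact one_ne_zero h.2
  -- `f i = ± f j` forces `i = j`
  have hne : ∀ i j, i ≠ j → f i ≠ f j ∧ f i ≠ -f j := by
    intro i j hij
    refine ⟨fun he ↦ hij ?_, fun he ↦ ?_⟩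
    · rw [hf i, hf j] at he
      have h := hrepr _ _ _ _ he
      simp only [cf] at h
      split_ifs at h with hi hj
      · exact Fin.ext (hcast hi hj h.2)
      · exact absurd h.1 one_ne_zero
      · exact absurd h.1.symm one_ne_zero
      · exact Fin.ext (by omega)
    · rw [hf i, hf j, hneg] at he
      have h := hrepr _ _ _ _ he
      simp only [cf] at h
      split_ifs at h with hi hj
      · exact hm1 h.1.symm
      · exact (one_ne_zero (α := ZMod p)) (by simpa using h.1)
      · exact (one_ne_zero (α := ZMod p)) (by simpa using h.1.symm)
      · exact hm1 h.2.symm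
  -- coordinates
  have hxy : ∀ j, ∃ (x y : AlgebraicClosure F)
      (h : (W.baseChange (AlgebraicClosure F)).toAffine.Nonsingular x y),
      ((f j : geomTorsion W (p : ℤ)) : geomPoints W) = Affine.Point.some x y h := fun j ↦
    W.exists_eq_some_of_ne_zero (fun h ↦ hf0 j (Subtype.ext h))
  choose xs ys hs hxs using hxy
  -- distinct `x`-coordinates
  have hxinj : Function.Injective xs := by
    intro i j hij
    by_contra hne'
    rcases eq_or_eq_neg_of_some_x_eq (h := hs i) (h' := hs j) hij.symm with h | h
    · exact (hne j i (Ne.symm hne')).1 (Subtype.ext (by rw [hxs j, hxs i]; exact h))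
    · exact (hne j i (Ne.symm hne')).2 (Subtype.ext (by
        rw [AddSubgroup.coe_neg, hxs j, hxs i]; exact h))
  -- not all of them are roots of `g`
  by_contra hall
  simp only [not_exists, not_and, not_not] at hall
  have hroots : ∀ j, xs j ∈ g.roots.toFinset := fun j ↦ by
    rw [Multiset.mem_toFinset, mem_roots hg0, IsRoot.def]
    exact hall (f j) (xs j) (ys j) (hs j) (hxs j)
  have hcard : (Finset.univ.image xs).card = p + 1 := by
    rw [Finset.card_image_of_injective _ hxinj, Finset.card_univ, Fintype.card_fin]
  have hle : (Finset.univ.image xs).card ≤ g.roots.toFinset.card :=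
    Finset.card_le_card (fun x hx ↦ by
      obtain ⟨j, -, rfl⟩ := Finset.mem_image.mp hx
      exact hroots j)
  have := (hle.trans (Multiset.toFinset_card_le _)).trans (g.card_roots'.trans hdeg)
  omega

/-! ### The criterion -/

/-- **Division-polynomial criterion for non-surjectivity.** Let `p` be an odd prime with
`p ≠ char F`, and let `g ∈ F[X]` with `0 < deg g ≤ p` divide the `p`-division polynomial `ψ_p`
(`W.preΨ p`) of `E = W/F`. Then `ρ̄_{E,p} : Γ_F → Aut(E[p])` is NOT surjective: a root of `g` is the
`x`-coordinate of a non-zero `P ∈ E[p]` (Ex. 3.7 (f)), some non-zero `Q ∈ E[p]` has `g(x(Q)) ≠ 0`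
(degree count), and `Γ_F` cannot move `P` to `Q`. Used with the Galois-stable pair of lines of a
split-Cartan-normaliser image (`deg g = p − 1`). [cite: Serre1972, §2.1]
[cite: SilvermanAEC2009, Exercise 3.7 (f)] [cite: Zywina2015, §1.3–1.4 (N_s(p))] -/
theorem not_hasSurjectiveModNGaloisRep_of_dvd_preΨ (p : ℕ) [Fact p.Prime] (hp2 : p ≠ 2)
    (hpF : (p : F) ≠ 0) (g : F[X]) (hdeg0 : 0 < g.natDegree) (hdeg : g.natDegree ≤ p)
    (hdvd : g ∣ W.preΨ (p : ℤ)) : ¬ W.HasSurjectiveModNGaloisRep (p : ℤ) := by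
  set Fbar := AlgebraicClosure F
  set V := W.baseChange Fbar with hV
  set g' : Fbar[X] := g.map (algebraMap F Fbar) with hg'
  have hg'deg : g'.natDegree = g.natDegree := natDegree_map _
  have hg'0 : g' ≠ 0 := by
    intro h; rw [h, natDegree_zero] at hg'deg; omega
  -- a root `α` of `g` over `F̄`, which is a root of `ΨSq_p`
  obtain ⟨α, hα⟩ := IsAlgClosed.exists_root g' (by
    rw [degree_eq_natDegree hg'0, hg'deg]; exact_mod_cast hdeg0.ne')
  have hp : p.Prime := Fact.out
  have hodd : ¬ Even (p : ℤ) := by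
    rw [Int.even_coe_nat, Nat.not_even_iff_odd]; exact hp.odd_of_ne_two hp2
  have hdvd' : g' ∣ V.ΨSq (p : ℤ) := by
    have h1 : V.preΨ (p : ℤ) = (W.preΨ (p : ℤ)).map (algebraMap F Fbar) :=
      W.map_preΨ (algebraMap F Fbar) (p : ℤ)
    have h2 : g' ∣ V.preΨ (p : ℤ) := by rw [h1, hg']; exact Polynomial.map_dvd _ hdvd
    have h3 : V.ΨSq (p : ℤ) = V.preΨ (p : ℤ) ^ 2 := by rw [ΨSq, if_neg hodd, mul_one]
    rw [h3]
    exact h2.trans (dvd_pow_self _ two_ne_zero)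
  have hΨα : (V.ΨSq (p : ℤ)).eval α = 0 := by
    obtain ⟨r, hr⟩ := hdvd'
    rw [hr, eval_mul, show g'.eval α = 0 from hα, zero_mul]
  obtain ⟨P, yP, hP, hPe⟩ := W.exists_geomTorsion_of_eval_ΨSq_eq_zero (p : ℤ) hΨα
  have hP0 : P ≠ 0 := fun h ↦ by
    have := congrArg Subtype.val h
    rw [hPe] at this
    exact Affine.Point.some_ne_zero _ this
  -- a torsion point missed by `g`
  obtain ⟨Q, xQ, yQ, hQ, hQe, hgQ⟩ :=
    W.exists_geomTorsion_eval_ne_zero p hp2 hpF g' hg'0 (hg'deg ▸ hdeg)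
  have hQ0 : Q ≠ 0 := fun h ↦ by
    have := congrArg Subtype.val h
    rw [hQe] at this
    exact Affine.Point.some_ne_zero _ this
  refine W.not_hasSurjectiveModNGaloisRep_of_aeval_eq_zero_of_ne p hpF g hP0 hQ0 hPe hQe ?_ ?_
  · rw [aeval_def, ← eval_map, ← hg']; exact hα
  · rw [aeval_def, ← eval_map, ← hg']; exact hgQ

end Torsion

/-! ### The short Weierstrass model over a field of characteristic `0` -/

/-- **Completing the square and the cube**: over a field of characteristic `0`, the change of
variables `(u, r, s, t) = (1, −b₂/12, −a₁/2, −(a₃ − a₁b₂/12)/2)` takes `W` to its short model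
`y² = x³ − (c₄/48) x − c₆/864`. [cite: SilvermanAEC2009, III.§1 (pp. 42–43)] -/
theorem shortModel_smul_eq {K : Type*} [Field K] [CharZero K] (V : WeierstrassCurve K) :
    (⟨1, -V.b₂ / 12, -V.a₁ / 2, -(V.a₃ - V.a₁ * V.b₂ / 12) / 2⟩ : VariableChange K) • V =
      ⟨0, 0, 0, -V.c₄ / 48, -V.c₆ / 864⟩ := by
  ext
  · simp only [variableChange_a₁, inv_one, Units.val_one]
    ring
  · simp only [variableChange_a₂, inv_one, Units.val_one, b₂]
    ring
  · simp only [variableChange_a₃, inv_one, Units.val_one]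
    ring
  · simp only [variableChange_a₄, inv_one, Units.val_one, b₂, c₄, b₄]
    ring
  · simp only [variableChange_a₆, inv_one, Units.val_one, b₂, c₆, b₄, b₆]
    ring


end WeierstrassCurve

end
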